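import Summits.FinalStateConjecture.FinalStateConjecture.Theorems.ClusterCompletenessOmegaLimitMultiKerrOmegaLimitSetConnected
import Summits.FinalStateConjecture.FinalStateConjecture.Theorems.ClusterCompletenessOmegaLimitMultiKerrUniqueLimitConvergence
import HarnessLib

/-!
# Route ClusterCompleteness · crux `OmegaLimitMultiKerr` — an ω-limit which is ISOLATED in the
# family of identified dark limits is THE limit of the late-time translates (LaSalle + connectedness)

Structure lemma for the crux stmt-FinalStateConjecture-14664 (`ClusterCompleteness.OmegaLimitMultiKerr`,
rank 9), line `Sketch`, lead gen 6, registered stub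
`tendsto_translate_sub_of_omegaLimits_mem_family_of_isolated` (closed form).

The LaSalle reading of the crux (`Cruxes/OmegaLimitMultiKerr/Lines/Sketch.md`): the late-time
translates `x ↦ h (x + t • e)` of a chart field `h` (`C^{k+1}` on an open domain `O ⊆ E` invariant
under translation by the Killing direction `e`) of a TAME development — all-late-time `C^{k+1}`
bounds on every compact — have `Cᵏ_loc` ω-limits ("dark limits") along every sequence of times
`Tₙ → +∞`: `Cᵏ` fields `g` on `O` with `supCkENorm K k (h (· + Tₙ • e) − g) → 0` on every compact
`K ⊆ O`. Two clauses of Hale 1980, Ch. I, §8, Thm. 8.1 are already in the tree in this currency: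
the ω-limit set is CONNECTED (`omegaLimits_not_separated`, `…OmegaLimitSetConnected`: it cannot be
covered by two families of `Cᵏ` fields at positive `Cᵏ(K)`-distance on one compact `K`, both met by
ω-limits), and a UNIQUE ω-limit is the limit through the reals
(`tendsto_supCkENorm_translate_sub_of_forall_omegaLimit_eq`, `…UniqueLimitConvergence`). This file
combines them into the form consumed by the dictionary, where the identification step produces a
CANDIDATE FAMILY `F p`, `p ∈ L`, of stationary configurations (the multi-Kerr charts with admissible
labels) containing every dark limit:

* `tendsto_translate_sub_of_omegaLimits_mem_family_of_isolated` (registered stub) — if every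
  `Cᵏ_loc` ω-limit of the translates of `h` agrees on `O` with some member `F p` (`p ∈ L`) of a
  family of `Cᵏ` fields on `O`, the reference member `F p₀` IS an ω-limit, and `F p₀` is ISOLATED
  in the family on one compact `K ⊆ O` (every `F p`, `p ∈ L`, either agrees with `F p₀` on `O` or is
  `δ`-far from it in `Cᵏ(K)`, `δ > 0`), then the translates converge to `F p₀` in `Cᵏ` on every
  compact `K' ⊆ O` as `t → +∞` THROUGH THE REALS: `supCkENorm K' k (h (· + t • e) − F p₀) → 0`.

Proof (Hale 1980, Ch. I, §8: a connected ω-limit set containing an isolated point is that point,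
and a one-point ω-limit set is the limit): by `tendsto_supCkENorm_translate_sub_of_forall_omegaLimit_eq`
it suffices that every ω-limit `g` agrees with `F p₀` on `O`. By the cover hypothesis `g = F p` on
`O` for some `p ∈ L`; if `F p = F p₀` on `O` we are done, and otherwise `F p` is `δ`-far from `F p₀`
in `Cᵏ(K)`, so the two families `A = {F p₀}` and
`B = {F q | q ∈ L, ‖F q − F p₀‖_{Cᵏ(K)} ≥ δ}` are `δ`-separated on `K`, cover the ω-limits (isolation
dichotomy), and are both met (`F p₀` by hypothesis, `F p ∈ B` along the times of `g`, the `Cᵏ` sup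
norm over a compact `K' ⊆ O` seeing only germs at points of `K'`, `supCkENorm_congr`) — contradicting
`omegaLimits_not_separated`. Everything is proved; Mathlib + the landed `…OmegaLimitSetConnected` /
`…UniqueLimitConvergence` files only; no definitions.

## References
* J. K. Hale, *Ordinary Differential Equations*, 2nd ed., Krieger 1980, Ch. I §8, Thm. 8.1 and
  Lemma 8.2 (the ω-limit set of a bounded positive semi-orbit is nonempty, compact, invariant and
  connected; a one-point ω-limit set is the limit). [Hale1980]
-/

-- every `Summit.FinalStateConjecture.FinalStateConjecture.…` name repeats the summit = sub-problem segment (D-0017 layout)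
set_option linter.dupNamespace false

noncomputable section

open Set Filter Topology Function
open scoped ContDiff Topology ENNReal

namespace Summit.FinalStateConjecture.FinalStateConjecture.Theorems.ClusterCompleteness

open Literature.Geometry.Lorentzian

/-- Swapping the two terms of a difference does not change its `Cᵏ` sup norm
(`Dᵐ (-f) = -Dᵐ f` unconditionally for Mathlib's `iteratedFDeriv`). [folklore] -/
private theorem supCkENorm_sub_swap' {F G : Type*} [NormedAddCommGroup F] [NormedSpace ℝ F]
    [NormedAddCommGroup G] [NormedSpace ℝ G] (S : Set F) (k : ℕ) (f g : F → G) :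
    supCkENorm S k (fun x ↦ f x - g x) = supCkENorm S k (fun x ↦ g x - f x) := by
  have hfg : (fun x ↦ f x - g x) = -fun x ↦ g x - f x := by
    funext x
    simp only [Pi.neg_apply, neg_sub]
  simp only [supCkENorm, hfg, iteratedFDeriv_neg_apply, enorm_neg]

/-- **An ω-limit isolated in the family of identified dark limits is the limit of the translates**
(registered structure stub of line `Sketch`, crux stmt-FinalStateConjecture-14664; closed form):
LaSalle + connectedness of the ω-limit set, Hale 1980, Ch. I, §8, Thm. 8.1, for the translation
flow `h ↦ h (· + t • e)` in the `Cᵏ_loc` topology. Let `O ⊆ E` be open and invariant under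
`x ↦ x + s • e` (`s ∈ ℝ`), `h : E → W` of class `C^{k+1}` on `O` and TAME along `e` (on every
compact `K ⊆ O` the derivatives of order `≤ k + 1` of `h` at the translated points `z + t • e`,
`z ∈ K`, are bounded uniformly for all late times `t ≥ a`). Let `F p`, `p ∈ L`, be a family of `Cᵏ`
fields on `O` such that every `Cᵏ_loc` ω-limit of the translates of `h` (every `Cᵏ` field `g` on
`O` with `supCkENorm K' k (h (· + Tₙ • e) − g) → 0` on all compacts `K' ⊆ O` along some `Tₙ → +∞`)
agrees on `O` with some `F p`, `p ∈ L`; suppose the reference member `F p₀` (`p₀ ∈ L`) is itself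
an ω-limit and is ISOLATED in the family on a compact `K ⊆ O`: every `F p`, `p ∈ L`, agrees with
`F p₀` on `O` or satisfies `‖F p − F p₀‖_{Cᵏ(K)} ≥ δ > 0`. Then
`supCkENorm K' k (h (· + t • e) − F p₀) → 0` as `t → +∞` through the reals, for every compact
`K' ⊆ O`. Proof: every ω-limit agrees with `F p₀` on `O` — otherwise `{F p₀}` and the `δ`-far
members of the family are two `δ`-separated families covering the ω-limits and both met,
contradicting `omegaLimits_not_separated` — and a unique ω-limit is the limit
(`tendsto_supCkENorm_translate_sub_of_forall_omegaLimit_eq`). [cite: Hale1980, Ch. I §8 Thm. 8.1] -/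
theorem tendsto_translate_sub_of_omegaLimits_mem_family_of_isolated :
    ∀ {E : Type*} [NormedAddCommGroup E] [NormedSpace ℝ E] [FiniteDimensional ℝ E]
      {W : Type*} [NormedAddCommGroup W] [NormedSpace ℝ W] [FiniteDimensional ℝ W]
      {O : Set E} {e : E}, IsOpen O → (∀ x ∈ O, ∀ s : ℝ, x + s • e ∈ O) →
      ∀ {k : ℕ} {h : E → W}, ContDiffOn ℝ (k + 1) h O →
      (∀ K ⊆ O, IsCompact K → ∃ Λ a : ℝ, ∀ t : ℝ, a ≤ t → ∀ i, i ≤ k + 1 → ∀ z ∈ K,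
        ‖iteratedFDeriv ℝ i h (z + t • e)‖ ≤ Λ) →
      ∀ {ι : Type*} (F : ι → E → W) (L : Set ι) (p₀ : ι), p₀ ∈ L →
      (∀ p ∈ L, ContDiffOn ℝ k (F p) O) →
      (∀ (g : E → W) (T : ℕ → ℝ), ContDiffOn ℝ k g O → Tendsto T atTop atTop →
        (∀ K' ⊆ O, IsCompact K' →
          Tendsto (fun n ↦ supCkENorm K' k (fun x ↦ h (x + T n • e) - g x)) atTop (𝓝 0)) →
        ∃ p ∈ L, ∀ x ∈ O, g x = F p x) →
      (∃ T : ℕ → ℝ, Tendsto T atTop atTop ∧ ∀ K' ⊆ O, IsCompact K' →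
        Tendsto (fun n ↦ supCkENorm K' k (fun x ↦ h (x + T n • e) - F p₀ x)) atTop (𝓝 0)) →
      ∀ (K : Set E), K ⊆ O → IsCompact K → ∀ {δ : ℝ}, 0 < δ →
      (∀ p ∈ L, (∀ x ∈ O, F p x = F p₀ x) ∨
        ENNReal.ofReal δ ≤ supCkENorm K k (fun x ↦ F p x - F p₀ x)) →
      ∀ K' ⊆ O, IsCompact K' →
        Tendsto (fun t : ℝ ↦ supCkENorm K' k (fun x ↦ h (x + t • e) - F p₀ x)) atTop (𝓝 0) := by
  intro E _ _ _ W _ _ _ O e hO hOe k h hh htame ι F L p₀ hp₀ hF hcover hmet K hKO hK δ hδ hiso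
    K' hK'O hK'
  -- a unique ω-limit is the limit: it suffices that every ω-limit agrees with `F p₀` on `O`
  refine tendsto_supCkENorm_translate_sub_of_forall_omegaLimit_eq hO hOe hh htame (F p₀) ?_
    K' hK'O hK'
  intro g T hg hT hconv
  -- the ω-limit `g` is a member `F p` of the family on `O` …
  obtain ⟨p, hp, hgp⟩ := hcover g T hg hT hconv
  -- … which either agrees with `F p₀` on `O` (done) or is `δ`-far from it in `Cᵏ(K)` (absurd)
  rcases hiso p hp with hpp₀ | hfar
  · intro x hx
    rw [hgp x hx, hpp₀ x hx]
  exfalso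
  -- the two families: `A = {F p₀}` and the `δ`-far members `B` of the family
  refine omegaLimits_not_separated hO hOe hh htame {F p₀}
    {f | ∃ q ∈ L, f = F q ∧ ENNReal.ofReal δ ≤ supCkENorm K k (fun x ↦ F q x - F p₀ x)}
    K hKO hK hδ ?_ ?_ ?_ ?_ ⟨F p₀, mem_singleton _, hmet⟩ ?_
  · -- members of `A` are `Cᵏ` on `O`
    intro f hf
    rw [mem_singleton_iff.1 hf]
    exact hF p₀ hp₀
  · -- members of `B` are `Cᵏ` on `O`
    rintro f ⟨q, hq, rfl, -⟩
    exact hF q hq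
  · -- `A` and `B` are `δ`-separated in `Cᵏ(K)`
    rintro f hf f' ⟨q, hq, rfl, hqfar⟩
    rw [mem_singleton_iff.1 hf, supCkENorm_sub_swap']
    exact hqfar
  · -- every ω-limit lies (on `O`) in `A` or in `B`: cover hypothesis + isolation dichotomy
    intro g' T' hg' hT' hconv'
    obtain ⟨q, hq, hgq⟩ := hcover g' T' hg' hT' hconv'
    rcases hiso q hq with hqp₀ | hqfar
    · exact Or.inl ⟨F p₀, mem_singleton _, fun x hx ↦ (hgq x hx).trans (hqp₀ x hx)⟩
    · exact Or.inr ⟨F q, ⟨q, hq, rfl, hqfar⟩, hgq⟩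
  · -- `B` is met: `F p ∈ B` is an ω-limit along `T`, since `g` is and `g = F p` on the open `O`
    refine ⟨F p, ⟨p, hp, rfl, hfar⟩, T, hT, fun K'' hK''O hK'' ↦ ?_⟩
    refine (hconv K'' hK''O hK'').congr fun n ↦ supCkENorm_congr fun x hx ↦ ?_
    filter_upwards [hO.mem_nhds (hK''O hx)] with y hy
    rw [hgp y hy]

end Summit.FinalStateConjecture.FinalStateConjecture.Theorems.ClusterCompleteness

end
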